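import Summits.ValiantsHypothesis.ValiantsHypothesis.Theorems.GrenetZeonDualUnipotentThreeHalvesLongMassNilSpaceEngel
import Summits.ValiantsHypothesis.ValiantsHypothesis.Theorems.GrenetZeonDualUnipotentThreeHalvesLongMassFlagWords

/-!
# `GrenetZeon.DualUnipotentThreeHalves` (stmt-ValiantsHypothesis-24318), line `slow_core`, stub (c) `SlowCore.LongMassSlowLawInv`:
# THE TRIANGULARISABLE LOCUS IS INTRINSIC — `V` is simultaneously strictly triangularisable iff ALL `V`-WORDS OF LENGTH `b` VANISH

Sequel of ✓ `…LongMassNilSpaceEngel` (Engel–McCoy: a Lie-closed nil space is strictly triangularisable).  The triangularisable row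
(✓ `TriangularRow.relCert_of_valueSpace_triangularisable`, `c = 3`) is hypothesised on a CONSTANT CHANGE OF BASIS `P`; here that hypothesis is
turned into a checkable algebraic condition on the value space `V ≤ M_b(ℂ)` itself, in the word currency of ✓ `…LongMassMixedWords` /
✓ `…LongMassNilSpaceWords`: the PURE `V`-words.

* §1 ★ `exists_flag_of_words_eq_zero` — if every product of `s` members of `V` vanishes, the WORD FLAG `F_i = span(V^i · ℂ^b)`
  (`ℂ^b = F₀ ⊇ F₁ ⊇ ⋯ ⊇ F_s = 0`) is lowered by every `A ∈ V`.
* §2 ★★ `exists_unit_conj_strictUpper_of_flag` — McCoy from ANY finite lowered flag (the assembly of ✓ `NilSpaceEngel`, flag as input);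
  ★★★ `exists_unit_conj_strictUpper_of_words_eq_zero` — all `V`-words of length `s` vanish ⇒ ONE unit `P` makes every `P A P⁻¹` strictly upper
  triangular.
* §3 ★★ the converse `words_eq_zero_of_conj_strictUpper` (conjugates of `b` strictly upper triangular `b × b` matrices multiply to `0`, by the
  coordinate flag and ✓ `word_eq_zero_of_drops`) and the criterion ★★★ `conj_strictUpper_iff_words_eq_zero`:
  «`V` simultaneously strictly triangularisable ⟺ every `V`-word of length `b` vanishes» (⟺ the non-unital algebra generated by `V` is nilpotent).
* §4 ★★ THE WORD ROW `relCert_of_valueSpace_words_eq_zero` — an affine pencil whose values lie in a space `V` all of whose words of some length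
  `s` vanish has `RelCert n m N (3·(⌊√n⌋·m))` ((c)'s conclusion, `c = 3`, `n₀ = 0`); `longMass_on_nilWords_locus` in the binder shape of the stub.
  Read next to ✓ `NilSpaceWords.mixedWords_eq_zero` (all MIXED word sums of length `≥ H` vanish on every nil space): on a (c)-violator some
  PURE `V`-word of length `b` survives (the value space generates a non-nilpotent algebra); its certificates are paid «by cancellation»
  (crit-7 V25), now by name.

HONEST FRAMING.  Calibration / dictionary (`--supports stmt-ValiantsHypothesis-24318`), classical (Levitzki–Jacobson: a nil multiplicative family
generates a nilpotent algebra; McCoy via Horn–Johnson §2.4.8); NOT progress on the research stub (c) `SlowCore.LongMassSlowLawInv`; closes no stub;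
S3, 24318, 8062 and `VP ≠ VNP` are NOT proved.  Def-free, no named-fact hypotheses, no sorry.
[cite: HornJohnson2013, Thm. 2.4.8.7 (p0162–0163)]
-/

set_option linter.dupNamespace false
set_option autoImplicit false

noncomputable section

namespace Summit.ValiantsHypothesis.ValiantsHypothesis.Theorems.GrenetZeon.NilSpaceEngel

open Matrix
open scoped BigOperators
open Summit.ValiantsHypothesis.ValiantsHypothesis.Cruxes.TwoDimCoefficients.DimTwoCases (AffMat IsAffine)
open Summit.ValiantsHypothesis.ValiantsHypothesis.Theorems.GrenetZeon.SlowCore (RelCert)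
open Summit.ValiantsHypothesis.ValiantsHypothesis.Theorems.GrenetZeon.TriangularRow (relCert_of_valueSpace_triangularisable)
open Summit.ValiantsHypothesis.ValiantsHypothesis.Theorems.GrenetZeon.LongMassHomogenise (word_eq_zero_of_drops)

variable {b : ℕ}

/-! ## §1 The word flag `F_i = span (V^i · ℂ^b)` -/

/-- Splitting off the LAST letter of a word: `(w₀ ⋯ w_i) v = (w₀ ⋯ w_{i−1}) (w_i v)`. -/
theorem prod_ofFn_succ_mulVec {i : ℕ} (w : Fin (i + 1) → Matrix (Fin b) (Fin b) ℂ) (v : Fin b → ℂ) :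
    (List.ofFn w).prod *ᵥ v = (List.ofFn fun t : Fin i => w (Fin.castSucc t)).prod *ᵥ (w (Fin.last i) *ᵥ v) := by
  rw [List.ofFn_succ', List.concat_eq_append, List.prod_append, List.prod_singleton, Matrix.mulVec_mulVec]

/-- Adding a FIRST letter: `A ((w₀ ⋯ w_{i−1}) v) = (A w₀ ⋯ w_{i−1}) v`. -/
theorem mulVec_prod_ofFn_mulVec {i : ℕ} (A : Matrix (Fin b) (Fin b) ℂ) (w : Fin i → Matrix (Fin b) (Fin b) ℂ) (v : Fin b → ℂ) :
    A *ᵥ ((List.ofFn w).prod *ᵥ v) = (List.ofFn (Fin.cons A w : Fin (i + 1) → Matrix (Fin b) (Fin b) ℂ)).prod *ᵥ v := by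
  rw [Matrix.mulVec_mulVec, List.ofFn_succ, List.prod_cons, Fin.cons_zero]
  simp only [Fin.cons_succ]

/-- ★ **THE WORD FLAG.**  If every product of `s` members of `V ≤ M_b(ℂ)` vanishes, there is a finite descending chain `ℂ^b = F₀ ⊇ F₁ ⊇ ⋯ ⊇ F_s = 0`
lowered by every `A ∈ V` (`F_i` = the span of the vectors `w·v`, `w` a `V`-word of length `i`). [folklore] -/
theorem exists_flag_of_words_eq_zero (V : Submodule ℂ (Matrix (Fin b) (Fin b) ℂ)) {s : ℕ}
    (hwords : ∀ w : Fin s → Matrix (Fin b) (Fin b) ℂ, (∀ t, w t ∈ V) → (List.ofFn w).prod = 0) :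
    ∃ F : ℕ → Submodule ℂ (Fin b → ℂ), F 0 = ⊤ ∧ F s = ⊥ ∧ (∀ i, F (i + 1) ≤ F i) ∧
      ∀ A ∈ V, ∀ i, ∀ v ∈ F i, A *ᵥ v ∈ F (i + 1) := by
  -- `S i` = the vectors `w·v`, `w` a `V`-word of length `i`
  set S : ℕ → Set (Fin b → ℂ) := fun i =>
    {u | ∃ (w : Fin i → Matrix (Fin b) (Fin b) ℂ) (v : Fin b → ℂ), (∀ t, w t ∈ V) ∧ u = (List.ofFn w).prod *ᵥ v} with hS
  refine ⟨fun i => Submodule.span ℂ (S i), ?_, ?_, fun i => ?_, fun A hA i v hv => ?_⟩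
  · -- length 0: every vector is `1·v`
    refine eq_top_iff.mpr fun v _ => Submodule.subset_span ⟨Fin.elim0, v, fun t => Fin.elim0 t, ?_⟩
    rw [List.ofFn_zero, List.prod_nil, Matrix.one_mulVec]
  · -- length `s`: every generator vanishes
    refine (Submodule.span_eq_bot).mpr ?_
    rintro u ⟨w, v, hw, rfl⟩
    rw [hwords w hw, Matrix.zero_mulVec]
  · -- descending: split off the last letter
    refine Submodule.span_mono ?_
    rintro u ⟨w, v, hw, rfl⟩
    exact ⟨fun t => w (Fin.castSucc t), w (Fin.last i) *ᵥ v, fun t => hw _, prod_ofFn_succ_mulVec w v⟩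
  · -- lowering: add a first letter
    have hmap : (Submodule.span ℂ (S i)).map (Matrix.mulVecLin A) ≤ Submodule.span ℂ (S (i + 1)) := by
      rw [Submodule.map_span]
      refine Submodule.span_mono ?_
      rintro _ ⟨u, ⟨w, v, hw, rfl⟩, rfl⟩
      refine ⟨Fin.cons A w, v, fun t => ?_, ?_⟩
      · refine Fin.cases ?_ (fun t => ?_) t
        · rw [Fin.cons_zero]; exact hA
        · rw [Fin.cons_succ]; exact hw t
      · rw [Matrix.mulVecLin_apply, mulVec_prod_ofFn_mulVec]
    have h := hmap (Submodule.mem_map_of_mem hv)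
    rwa [Matrix.mulVecLin_apply] at h

/-! ## §2 McCoy from a lowered flag; words ⇒ triangularisable -/

/-- ★★ **STRICT TRIANGULARISATION FROM A LOWERED FLAG** (McCoy, Horn–Johnson Thm. 2.4.8.7 + 2.4.8.6, assembled as in ✓ `NilSpaceEngel`): if
every member of `V ≤ M_b(ℂ)` lowers a finite descending chain `ℂ^b = F₀ ⊇ ⋯ ⊇ F_s = 0` and `V` is closed under the commutator MODULO the flag
(the commutators lower it too — automatic when products of members lower twice), one unit `P` makes every `P A P⁻¹`, `A ∈ V`, strictly upper
triangular. [cite: HornJohnson2013, Thm. 2.4.8.7 (p0162)] -/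
theorem exists_unit_conj_strictUpper_of_flag (V : Submodule ℂ (Matrix (Fin b) (Fin b) ℂ)) (F : ℕ → Submodule ℂ (Fin b → ℂ))
    (hF0 : F 0 = ⊤) {s : ℕ} (hFs : F s = ⊥) (hanti : ∀ i, F (i + 1) ≤ F i)
    (hlow : ∀ A ∈ V, ∀ i, ∀ v ∈ F i, A *ᵥ v ∈ F (i + 1)) :
    ∃ P : (Matrix (Fin b) (Fin b) ℂ)ˣ, ∀ A ∈ V, ∀ i j : Fin b, j ≤ i →
      ((P : Matrix (Fin b) (Fin b) ℂ) * A * (↑P⁻¹ : Matrix (Fin b) (Fin b) ℂ)) i j = 0 := by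
  -- commutators of members lower the flag (products lower twice)
  have hcomm : ∀ A ∈ V, ∀ B ∈ V, ∀ i, ∀ v ∈ F i, (A * B - B * A) *ᵥ v ∈ F (i + 1) := by
    intro A hA B hB i v hv
    rw [Matrix.sub_mulVec, ← Matrix.mulVec_mulVec, ← Matrix.mulVec_mulVec]
    exact (F (i + 1)).sub_mem (hanti _ (hlow A hA _ _ (hlow B hB i v hv))) (hanti _ (hlow B hB _ _ (hlow A hA i v hv)))
  set fam : V → Matrix (Fin b) (Fin b) ℂ := fun k => (k : Matrix (Fin b) (Fin b) ℂ) with hfam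
  have hMcCoy : ∀ (p : FreeAlgebra ℂ V) (k l : V), IsNilpotent (FreeAlgebra.lift ℂ fam p * (fam k * fam l - fam l * fam k)) :=
    fun p k l => isNilpotent_lift_mul_comm_of_lowers F hF0 hFs hanti fam (fun k => hlow k.1 k.2) k l
      (hcomm k.1 k.2 l.1 l.2) p
  obtain ⟨S, hS, htri⟩ :=
    (Literature.LinearAlgebra.Matrix.SimultaneousTriangularization.forall_isNilpotent_iff_exists_isUnit fam).mp hMcCoy
  obtain ⟨u, hu⟩ := hS
  have hSdet : IsUnit S.det := (Matrix.isUnit_iff_isUnit_det S).mp ⟨u, hu⟩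
  refine ⟨u⁻¹, fun A hA i j hji => ?_⟩
  have hP : ((u⁻¹ : (Matrix (Fin b) (Fin b) ℂ)ˣ) : Matrix (Fin b) (Fin b) ℂ) = S⁻¹ := by
    rw [Matrix.coe_units_inv, hu]
  have hPinv : ((u⁻¹⁻¹ : (Matrix (Fin b) (Fin b) ℂ)ˣ) : Matrix (Fin b) (Fin b) ℂ) = S := by
    rw [inv_inv, hu]
  rw [hP, hPinv]
  have hT : (S⁻¹ * A * S).BlockTriangular id := htri ⟨A, hA⟩
  have hpow : ∀ k : ℕ, (S⁻¹ * A * S) ^ k = S⁻¹ * A ^ k * S := by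
    intro k
    induction k with
    | zero => rw [pow_zero, pow_zero, Matrix.mul_one, Matrix.nonsing_inv_mul S hSdet]
    | succ k ih =>
      rw [pow_succ, ih, pow_succ]
      calc S⁻¹ * A ^ k * S * (S⁻¹ * A * S) = S⁻¹ * A ^ k * (S * S⁻¹) * A * S := by
            simp only [Matrix.mul_assoc]
        _ = S⁻¹ * (A ^ k * A) * S := by rw [Matrix.mul_nonsing_inv S hSdet, Matrix.mul_one, Matrix.mul_assoc S⁻¹]
  have hTnil : IsNilpotent (S⁻¹ * A * S) :=
    ⟨s, by rw [hpow, pow_eq_zero_of_lowers F hF0 hFs A (hlow A hA), Matrix.mul_zero, Matrix.zero_mul]⟩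
  exact apply_eq_zero_of_blockTriangular_of_isNilpotent hT hTnil hji

/-- ★★★ **ALL WORDS OF LENGTH `s` VANISH ⇒ SIMULTANEOUSLY STRICTLY TRIANGULARISABLE.**  If every product of `s` members of `V ≤ M_b(ℂ)` is
zero (the non-unital algebra generated by `V` is nilpotent), one unit `P` makes every `P A P⁻¹`, `A ∈ V`, strictly upper triangular. [folklore] -/
theorem exists_unit_conj_strictUpper_of_words_eq_zero (V : Submodule ℂ (Matrix (Fin b) (Fin b) ℂ)) {s : ℕ}
    (hwords : ∀ w : Fin s → Matrix (Fin b) (Fin b) ℂ, (∀ t, w t ∈ V) → (List.ofFn w).prod = 0) :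
    ∃ P : (Matrix (Fin b) (Fin b) ℂ)ˣ, ∀ A ∈ V, ∀ i j : Fin b, j ≤ i →
      ((P : Matrix (Fin b) (Fin b) ℂ) * A * (↑P⁻¹ : Matrix (Fin b) (Fin b) ℂ)) i j = 0 := by
  obtain ⟨F, hF0, hFs, hanti, hlow⟩ := exists_flag_of_words_eq_zero V hwords
  exact exists_unit_conj_strictUpper_of_flag V F hF0 hFs hanti hlow

/-! ## §3 The converse and the criterion -/

/-- Conjugation passes through words: `∏ (P w_t Q) = P (∏ w_t) Q` when `Q P = 1`. -/
theorem prod_ofFn_conj (P Q : Matrix (Fin b) (Fin b) ℂ) (hQP : Q * P = 1) :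
    ∀ {s : ℕ} (w : Fin s → Matrix (Fin b) (Fin b) ℂ), 1 ≤ s →
      (List.ofFn fun t => P * w t * Q).prod = P * (List.ofFn w).prod * Q
  | 0, _, h => absurd h (by omega)
  | 1, w, _ => by simp [List.ofFn_succ]
  | s + 2, w, _ => by
    rw [List.ofFn_succ, List.prod_cons, List.ofFn_succ (f := w), List.prod_cons,
      prod_ofFn_conj P Q hQP (fun t => w t.succ) (by omega)]
    calc P * w 0 * Q * (P * (List.ofFn fun t : Fin (s + 1) => w t.succ).prod * Q)
        = P * w 0 * (Q * P) * (List.ofFn fun t : Fin (s + 1) => w t.succ).prod * Q := by simp only [Matrix.mul_assoc]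
      _ = P * (w 0 * (List.ofFn fun t : Fin (s + 1) => w t.succ).prod) * Q := by rw [hQP, Matrix.mul_one, Matrix.mul_assoc P]

/-- ★ **`b` STRICTLY UPPER TRIANGULAR `b × b` MATRICES MULTIPLY TO ZERO** (the coordinate flag `F_i = {v : v_j = 0 for j ≥ i}` and
✓ `word_eq_zero_of_drops`). [folklore] -/
theorem prod_eq_zero_of_strictUpper (w : Fin b → Matrix (Fin b) (Fin b) ℂ) (hw : ∀ t, ∀ i j : Fin b, j ≤ i → w t i j = 0) :
    (List.ofFn w).prod = 0 := by
  classical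
  -- the coordinate flag
  set F : ℕ → Submodule ℂ (Fin b → ℂ) := fun i => ⨅ (j : Fin b) (_ : i ≤ (j : ℕ)), LinearMap.ker (LinearMap.proj j) with hF
  have hmem : ∀ i (v : Fin b → ℂ), v ∈ F i ↔ ∀ j : Fin b, i ≤ (j : ℕ) → v j = 0 := by
    intro i v
    simp only [hF, Submodule.mem_iInf, LinearMap.mem_ker, LinearMap.proj_apply]
  have hmono : Monotone F := by
    intro i i' hii' v hv
    rw [hmem] at hv ⊢
    exact fun j hj => hv j (le_trans hii' hj)
  have hF0 : F 0 = ⊥ := by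
    refine eq_bot_iff.mpr fun v hv => ?_
    rw [hmem] at hv
    rw [Submodule.mem_bot]
    exact funext fun j => hv j (Nat.zero_le _)
  have hFb : F b = ⊤ := by
    refine eq_top_iff.mpr fun v _ => ?_
    rw [hmem]
    exact fun j hj => absurd j.isLt (not_lt.mpr hj)
  refine word_eq_zero_of_drops F hmono hF0 hFb w (fun _ => 1) (fun t i v hv => ?_) (by simp)
  rw [hmem] at hv ⊢
  intro j hj
  rw [Matrix.mulVec, dotProduct]
  refine Finset.sum_eq_zero fun l _ => ?_
  by_cases hlj : l ≤ j
  · rw [hw t j l hlj, zero_mul]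
  · rw [hv l (by push Not at hlj; have := hlj; omega), mul_zero]

/-- ★★ **CONVERSE**: if one unit `P` makes every `P A P⁻¹`, `A ∈ V`, strictly upper triangular, then every `V`-word of length `b` vanishes. [folklore] -/
theorem words_eq_zero_of_conj_strictUpper (V : Submodule ℂ (Matrix (Fin b) (Fin b) ℂ)) (P : (Matrix (Fin b) (Fin b) ℂ)ˣ)
    (hP : ∀ A ∈ V, ∀ i j : Fin b, j ≤ i → ((P : Matrix (Fin b) (Fin b) ℂ) * A * (↑P⁻¹ : Matrix (Fin b) (Fin b) ℂ)) i j = 0)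
    (w : Fin b → Matrix (Fin b) (Fin b) ℂ) (hw : ∀ t, w t ∈ V) : (List.ofFn w).prod = 0 := by
  rcases Nat.eq_zero_or_pos b with hb | hb
  · subst hb
    ext i _; exact Fin.elim0 i
  set Pm : Matrix (Fin b) (Fin b) ℂ := (P : Matrix (Fin b) (Fin b) ℂ) with hPm
  set Qm : Matrix (Fin b) (Fin b) ℂ := (↑P⁻¹ : Matrix (Fin b) (Fin b) ℂ) with hQm
  have hQP : Qm * Pm = 1 := by
    rw [hPm, hQm, ← Units.val_mul, inv_mul_cancel, Units.val_one]
  have h := prod_eq_zero_of_strictUpper (fun t => Pm * w t * Qm) (fun t i j hji => hP _ (hw t) i j hji)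
  rw [prod_ofFn_conj _ _ hQP w hb] at h
  have h2 : Qm * (Pm * (List.ofFn w).prod * Qm) * Pm = (List.ofFn w).prod := by
    calc Qm * (Pm * (List.ofFn w).prod * Qm) * Pm = (Qm * Pm) * (List.ofFn w).prod * (Qm * Pm) := by
          simp only [Matrix.mul_assoc]
      _ = (List.ofFn w).prod := by rw [hQP, Matrix.one_mul, Matrix.mul_one]
  rw [← h2, h, Matrix.mul_zero, Matrix.zero_mul]

/-- ★★★ **THE CRITERION: `V ≤ M_b(ℂ)` IS SIMULTANEOUSLY STRICTLY TRIANGULARISABLE IFF EVERY `V`-WORD OF LENGTH `b` VANISHES** (iff the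
non-unital algebra generated by `V` is nilpotent).  The triangularisable locus of the (c)-menu is thus an intrinsic, checkable condition on the
value space. [folklore] -/
theorem conj_strictUpper_iff_words_eq_zero (V : Submodule ℂ (Matrix (Fin b) (Fin b) ℂ)) :
    (∃ P : (Matrix (Fin b) (Fin b) ℂ)ˣ, ∀ A ∈ V, ∀ i j : Fin b, j ≤ i →
        ((P : Matrix (Fin b) (Fin b) ℂ) * A * (↑P⁻¹ : Matrix (Fin b) (Fin b) ℂ)) i j = 0) ↔
      ∀ w : Fin b → Matrix (Fin b) (Fin b) ℂ, (∀ t, w t ∈ V) → (List.ofFn w).prod = 0 :=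
  ⟨fun ⟨P, hP⟩ w hw => words_eq_zero_of_conj_strictUpper V P hP w hw, fun h => exists_unit_conj_strictUpper_of_words_eq_zero V h⟩

/-! ## §4 THE WORD ROW: (c)'s conclusion with `c = 3` when all pure words of some length vanish -/

variable {n m : ℕ}

/-- ★★ **THE WORD ROW.**  An affine pencil `N` whose values lie in a space `V ≤ M_m(ℂ)` all of whose words of some length `s` vanish has
`RelCert n m N (3·(⌊√n⌋·m))` — (c)'s conclusion with `c = 3`, `n₀ = 0` (word flag + McCoy + ✓ `relCert_of_valueSpace_triangularisable`).
[cite: HornJohnson2013, Thm. 2.4.8.7 (p0162)] -/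
theorem relCert_of_valueSpace_words_eq_zero (N : AffMat n m) (hN : IsAffine N)
    (V : Submodule ℂ (Matrix (Fin m) (Fin m) ℂ)) (hV : ∀ x : Fin n × Fin n → ℂ, N.map (MvPolynomial.eval x) ∈ V) {s : ℕ}
    (hwords : ∀ w : Fin s → Matrix (Fin m) (Fin m) ℂ, (∀ t, w t ∈ V) → (List.ofFn w).prod = 0) :
    RelCert n m N (3 * (Nat.sqrt n * m)) := by
  obtain ⟨P, hP⟩ := exists_unit_conj_strictUpper_of_words_eq_zero V hwords
  exact relCert_of_valueSpace_triangularisable N hN V hV P hP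

/-- ★ **(c) ON THE NIL-WORDS LOCUS**, in the binder shape of the stub `SlowCore.LongMassSlowLawInv` with `c = 3`, `n₀ = 0`: the hypotheses
`B ^ b = 0` / `IrreducibleInv B` replaced by «the values of `B` lie in a space all of whose words of length `b` vanish» — by
`conj_strictUpper_iff_words_eq_zero` this IS the triangularisable locus (✓ `TriangularRow.longMass_on_triangularisable_locus`), stated without
a change of basis.  NOT an instance of the stub (irreducible value spaces of size `b ≥ 2` generate `M_b(ℂ)`). [folklore] -/
theorem longMass_on_nilWords_locus :
    ∀ n b : ℕ, ∀ B : AffMat n b, IsAffine B →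
      (∃ V : Submodule ℂ (Matrix (Fin b) (Fin b) ℂ), (∀ x : Fin n × Fin n → ℂ, B.map (MvPolynomial.eval x) ∈ V) ∧
        ∀ w : Fin b → Matrix (Fin b) (Fin b) ℂ, (∀ t, w t ∈ V) → (List.ofFn w).prod = 0) →
      RelCert n b B (3 * (Nat.sqrt n * b)) := by
  intro n b B hB hV
  obtain ⟨V, hV, hwords⟩ := hV
  exact relCert_of_valueSpace_words_eq_zero B hB V hV hwords

end Summit.ValiantsHypothesis.ValiantsHypothesis.Theorems.GrenetZeon.NilSpaceEngel

end
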